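import Summits.AtomisticToContinuum.BoseEinsteinCondensation.Theorems.BECThomsonPrincipleGDTransferSeededPlainFormBridge
import Summits.AtomisticToContinuum.BoseEinsteinCondensation.Theorems.BECThomsonPrincipleGDTransferSeededPlainAdjoint

/-!
# Route `BECThomsonPrinciple`, crux `GDTransfer` (stmt-AtomisticToContinuum-9482), line `seeded-continuity`:
# stub `stub_plainPairCost`, part 3 — the double-commutator estimate of the plain pair at a state

Support file of the registered stub `stub_plainPairCost`.  For a direction `ψ` of finite energy form and a mode `n`,
with `a = ζ₊ψ`, `b = ζ₋ψ` (the plain pair) and the excess form `q̃ = 𝓔 − E₀‖·‖² ≥ 0`: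

  `q̃(a) + q̃(b) = 𝒟^kin + 𝒟^V + q̃(ζ₋ζ₊ψ, ψ) + q̃(ζ₊ζ₋ψ, ψ)`,

where (i) the KINETIC double commutator is exact, `𝒟^kin = Re[t(a,a) + t(b,b) − t(ζ₋ζ₊ψ,ψ) − t(ζ₊ζ₋ψ,ψ)] =
|k|²(‖a‖² − ‖b‖²)` (`kinetic_doubleCommutator`: the hypothesis `PlainKineticIdentity` used twice plus the
adjointness `⟨f, ζ₊g⟩ = ⟨ζ₋f, g⟩`), (ii) `𝒟^V = plainInteractionDefect` by definition, (iii) the `E₀`-parts of the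
cross terms cancel against `E₀(‖a‖² + ‖b‖²)` by adjointness (`⟨ζ₋ζ₊ψ, ψ⟩ = ‖a‖²`, `⟨ζ₊ζ₋ψ, ψ⟩ = ‖b‖²`), and (iv) the
polar cross terms are bounded by Cauchy–Schwarz for `q̃`, `|q̃(w, ψ)| ≤ √(𝓔(w) q̃(ψ))` (`cross_sq_le`).  Result:
`core_estimate`.  All [folklore] (KennedyLiebShastry1988 (12)–(14); PitaevskiiStringari1991).
-/

noncomputable section

open MeasureTheory Filter
open scoped ENNReal NNReal ComplexConjugate

namespace Summit.AtomisticToContinuum.BoseEinsteinCondensation.Cruxes.GDTransfer.Seeded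

namespace PlainCost

open Literature.MathematicalPhysics.QuantumManyBody.BoseGas
open Summit.AtomisticToContinuum.BoseEinsteinCondensation.Cruxes.GDTransfer.DysonDressedWitness

variable {m : ℕ} {L : ℝ} {v : ℝ → ℝ≥0∞}

/-! ## The kinetic double commutator is exact -/

/-- **`𝒟^kin = |k|²(‖ζ₊ψ‖² − ‖ζ₋ψ‖²)`**: from the kinetic identity `t(f, ζ₊g) − t(ζ₋f, g) = |k|²⟨f, ζ₊g⟩` at
`(f, g) = (ζ₊ψ, ψ)` and `(ψ, ζ₋ψ)`, conjugate symmetry of `t` and the adjointness `⟨ψ, ζ₊ζ₋ψ⟩ = ‖ζ₋ψ‖²`. [folklore] -/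
theorem kinetic_doubleCommutator (hK : PlainKineticIdentity) (hL : 0 < L) (n : Fin 3 → ℤ)
    {ψ : Config (m + 1) → ℂ} (hψ : IsDirection m L ψ) :
    (tform m L (plainUp m L n ψ) (plainUp m L n ψ)).re + (tform m L (plainDown m L n ψ) (plainDown m L n ψ)).re -
        (tform m L (plainDown m L n (plainUp m L n ψ)) ψ).re -
          (tform m L (plainUp m L n (plainDown m L n ψ)) ψ).re =
      (2 * Real.pi / L) ^ 2 * (∑ i : Fin 3, ((n i : ℝ)) ^ 2) *
        ((mass L (plainUp m L n ψ)).toReal - (mass L (plainDown m L n ψ)).toReal) := by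
  have ha : IsDirection m L (plainUp m L n ψ) := PlainAlgebra.isDirection_plainUp hL.ne' n hψ
  have hb : IsDirection m L (plainDown m L n ψ) := PlainAlgebra.isDirection_plainDown n hψ
  have hψc : Continuous ψ := hψ.contDiff.continuous
  have hac : Continuous (plainUp m L n ψ) := ha.contDiff.continuous
  have hbc : Continuous (plainDown m L n ψ) := hb.contDiff.continuous
  have h1 := hK m L hL n (plainUp m L n ψ) ψ ha.contDiff ha.periodic hψ.contDiff hψ.periodic
  have h2 := hK m L hL n ψ (plainDown m L n ψ) hψ.contDiff hψ.periodic hb.contDiff hb.periodic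
  rw [inner_plainUp n hψc hbc] at h2
  have h1r := congrArg Complex.re h1
  have h2r := congrArg Complex.re h2
  rw [Complex.sub_re, Complex.re_ofReal_mul, ← mass_toReal_eq L hac] at h1r
  rw [Complex.sub_re, Complex.re_ofReal_mul, ← mass_toReal_eq L hbc,
    tform_re_comm (plainUp m L n (plainDown m L n ψ)) ψ] at h2r
  linear_combination h1r - h2r

/-! ## The double-commutator estimate at a state -/

/-- **The KLS double-commutator estimate of the plain pair at a direction `ψ`** of finite energy form:
`𝓔(a) + 𝓔(b) ≤ E₀(‖a‖² + ‖b‖²) + |k|²(‖a‖² − ‖b‖²) + 𝒟^V(ψ) + √(𝓔(ζ₋ζ₊ψ) q̃(ψ)) + √(𝓔(ζ₊ζ₋ψ) q̃(ψ))`,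
`a = ζ₊ψ`, `b = ζ₋ψ`, `q̃(ψ) = 𝓔(ψ) − E₀‖ψ‖²`, in real numbers. [folklore] -/
theorem core_estimate (hK : PlainKineticIdentity) (hv : Measurable v) (hL : 0 < L) (n : Fin 3 → ℤ)
    {ψ : Config (m + 1) → ℂ} (hψ : IsDirection m L ψ) (hψe : eform v L ψ ≠ ⊤)
    (hae : eform v L (plainUp m L n ψ) ≠ ⊤) (hbe : eform v L (plainDown m L n ψ) ≠ ⊤)
    (hUDe : eform v L (plainUp m L n (plainDown m L n ψ)) ≠ ⊤)
    (hDUe : eform v L (plainDown m L n (plainUp m L n ψ)) ≠ ⊤) :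
    (eform v L (plainUp m L n ψ)).toReal + (eform v L (plainDown m L n ψ)).toReal ≤
      (periodicGroundStateEnergy v (m + 1) L).toReal *
          ((mass L (plainUp m L n ψ)).toReal + (mass L (plainDown m L n ψ)).toReal) +
        (2 * Real.pi / L) ^ 2 * (∑ i : Fin 3, ((n i : ℝ)) ^ 2) *
          ((mass L (plainUp m L n ψ)).toReal - (mass L (plainDown m L n ψ)).toReal) +
        plainInteractionDefect v m L n ψ +
        (Real.sqrt ((eform v L (plainDown m L n (plainUp m L n ψ))).toReal *
            ((eform v L ψ).toReal - (periodicGroundStateEnergy v (m + 1) L).toReal * (mass L ψ).toReal)) +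
          Real.sqrt ((eform v L (plainUp m L n (plainDown m L n ψ))).toReal *
            ((eform v L ψ).toReal - (periodicGroundStateEnergy v (m + 1) L).toReal * (mass L ψ).toReal))) := by
  have ha : IsDirection m L (plainUp m L n ψ) := PlainAlgebra.isDirection_plainUp hL.ne' n hψ
  have hb : IsDirection m L (plainDown m L n ψ) := PlainAlgebra.isDirection_plainDown n hψ
  have hUD : IsDirection m L (plainUp m L n (plainDown m L n ψ)) :=
    PlainAlgebra.isDirection_plainUp hL.ne' n hb
  have hDU : IsDirection m L (plainDown m L n (plainUp m L n ψ)) :=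
    PlainAlgebra.isDirection_plainDown n ha
  have hψc : Continuous ψ := hψ.contDiff.continuous
  have hac : Continuous (plainUp m L n ψ) := ha.contDiff.continuous
  have hbc : Continuous (plainDown m L n ψ) := hb.contDiff.continuous
  -- the bridges at the diagonal
  have Ea := eform_toReal_eq hv ha.contDiff hae
  have Eb := eform_toReal_eq hv hb.contDiff hbe
  -- the `E₀`-parts of the cross terms: adjointness
  have A1 : (∫ X in cellN (m + 1) L, conj (plainDown m L n (plainUp m L n ψ) X) * ψ X).re =
      (mass L (plainUp m L n ψ)).toReal := by
    rw [← inner_plainUp n hac hψc, mass_toReal_eq L hac]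
  have A2 : (∫ X in cellN (m + 1) L, conj (plainUp m L n (plainDown m L n ψ) X) * ψ X).re =
      (mass L (plainDown m L n ψ)).toReal := by
    rw [inner_re_comm ψ (plainUp m L n (plainDown m L n ψ)), inner_plainUp n hψc hbc, mass_toReal_eq L hbc]
  -- the kinetic double commutator
  have T := kinetic_doubleCommutator hK hL n hψ
  -- the interaction double commutator, by definition
  have DV : plainInteractionDefect v m L n ψ =
      (vform v m L (plainUp m L n ψ) (plainUp m L n ψ)).re +
        (vform v m L (plainDown m L n ψ) (plainDown m L n ψ)).re -
          (vform v m L (plainUp m L n (plainDown m L n ψ)) ψ).re -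
            (vform v m L (plainDown m L n (plainUp m L n ψ)) ψ).re := by
    unfold plainInteractionDefect
    simp only [Complex.sub_re, Complex.add_re]
  -- Cauchy–Schwarz for the two cross terms
  set qψ : ℝ := (eform v L ψ).toReal - (periodicGroundStateEnergy v (m + 1) L).toReal * (mass L ψ).toReal
    with hqψ
  have hq0 : 0 ≤ qψ := by
    rw [hqψ]; linarith [ChordVariation.e0_mul_mass_le_eform_toReal v hψ hψe]
  have CS1 := cross_sq_le hv hDU hψ hDUe hψe
  have CS2 := cross_sq_le hv hUD hψ hUDe hψe
  have hDU0 := ChordVariation.e0_mul_mass_le_eform_toReal v hDU hDUe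
  have hUD0 := ChordVariation.e0_mul_mass_le_eform_toReal v hUD hUDe
  have hmDU : 0 ≤ (periodicGroundStateEnergy v (m + 1) L).toReal *
      (mass L (plainDown m L n (plainUp m L n ψ))).toReal := by positivity
  have hmUD : 0 ≤ (periodicGroundStateEnergy v (m + 1) L).toReal *
      (mass L (plainUp m L n (plainDown m L n ψ))).toReal := by positivity
  have S1 : (tform m L (plainDown m L n (plainUp m L n ψ)) ψ).re +
      (vform v m L (plainDown m L n (plainUp m L n ψ)) ψ).re -
        (periodicGroundStateEnergy v (m + 1) L).toReal *
          (∫ X in cellN (m + 1) L, conj (plainDown m L n (plainUp m L n ψ) X) * ψ X).re ≤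
      Real.sqrt ((eform v L (plainDown m L n (plainUp m L n ψ))).toReal * qψ) := by
    refine (le_abs_self _).trans ((Real.abs_le_sqrt CS1).trans (Real.sqrt_le_sqrt ?_))
    exact mul_le_mul_of_nonneg_right (by linarith) hq0
  have S2 : (tform m L (plainUp m L n (plainDown m L n ψ)) ψ).re +
      (vform v m L (plainUp m L n (plainDown m L n ψ)) ψ).re -
        (periodicGroundStateEnergy v (m + 1) L).toReal *
          (∫ X in cellN (m + 1) L, conj (plainUp m L n (plainDown m L n ψ) X) * ψ X).re ≤
      Real.sqrt ((eform v L (plainUp m L n (plainDown m L n ψ))).toReal * qψ) := by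
    refine (le_abs_self _).trans ((Real.abs_le_sqrt CS2).trans (Real.sqrt_le_sqrt ?_))
    exact mul_le_mul_of_nonneg_right (by linarith) hq0
  rw [A1] at S1
  rw [A2] at S2
  linarith [Ea, Eb, T, DV, S1, S2]

end PlainCost

/-- **Part 3 of `stub_plainPairCost` (registered helper statement)**: the exact kinetic double commutator of the
plain pair — under `PlainKineticIdentity`, for every direction `ψ`,
`Re[t(ζ₊ψ,ζ₊ψ) + t(ζ₋ψ,ζ₋ψ) − t(ζ₋ζ₊ψ,ψ) − t(ζ₊ζ₋ψ,ψ)] = (2π/L)²|n|²(‖ζ₊ψ‖² − ‖ζ₋ψ‖²)`. [folklore] -/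
theorem plainPairCost_kinetic_doubleCommutator :
    PlainKineticIdentity → ∀ (m : ℕ) (L : ℝ), 0 < L → ∀ (n : Fin 3 → ℤ)
      (ψ : Literature.MathematicalPhysics.QuantumManyBody.BoseGas.Config (m + 1) → ℂ),
      Summit.AtomisticToContinuum.BoseEinsteinCondensation.Cruxes.GDTransfer.DysonDressedWitness.IsDirection m L ψ →
        (tform m L (plainUp m L n ψ) (plainUp m L n ψ)).re + (tform m L (plainDown m L n ψ) (plainDown m L n ψ)).re -
            (tform m L (plainDown m L n (plainUp m L n ψ)) ψ).re -
              (tform m L (plainUp m L n (plainDown m L n ψ)) ψ).re =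
          (2 * Real.pi / L) ^ 2 * (∑ i : Fin 3, ((n i : ℝ)) ^ 2) *
            ((Summit.AtomisticToContinuum.BoseEinsteinCondensation.Cruxes.GDTransfer.DysonDressedWitness.mass L
                (plainUp m L n ψ)).toReal -
              (Summit.AtomisticToContinuum.BoseEinsteinCondensation.Cruxes.GDTransfer.DysonDressedWitness.mass L
                (plainDown m L n ψ)).toReal) :=
  fun hK _ _ hL n _ hψ => PlainCost.kinetic_doubleCommutator hK hL n hψ

end Summit.AtomisticToContinuum.BoseEinsteinCondensation.Cruxes.GDTransfer.Seeded

end
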